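import Mathlib

/-!
# Solo (informed) rung s28/4: the three-strand ray profile and the formal reading of the W-line

Setting (paper §16.13(j)(1), §16.12(h)(5) s28 extension): for an inert `w = 1` field the class
module has three eigen-generators, `T = {1, 3, 5}`, and the ray profile of a Kummer line `η` is
`V_k = 1 + 3⌈k/2⌉ - [k = 5] + N_k - [k = 5]·ν` (`0 ≤ k ≤ 6`), `N_k` counting the admissible
colengths of `soloInformed_ray_pairs` over the three strands of lengths `ℓ₁, ℓ₃, ℓ₅ ∈ [1, 7]`.

* `soloInformed_ray_profile3`: the closed form of the three-strand profile,
  `(1 + [ℓ₁ ≥ 1], 4 + [ℓ₁ ≥ 2], 5 + [ℓ₁ ≥ 3], 7 + [ℓ₃ ≥ 2] + [ℓ₁ ≥ 4], 8 + [ℓ₃ ≥ 3] + [ℓ₁ ≥ 5],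
    9 + [ℓ₃ ≥ 4] + [ℓ₅ ≥ 2] + [ℓ₁ ≥ 6], 11 + [ℓ₃ ≥ 5] + [ℓ₅ ≥ 3] + [ℓ₁ ≥ 7])` before the `ν`-term.
* `soloInformed_wline_formal_reading`: the profile `(2, 5, 6, 8, 9, 10, 11)` observed at the
  unramified W-line of EVERY inert `w = 1` census field with `a ∈ {(1,1,1), (1,1,2)}` (17 fields, rigid and
  linear alike) has exactly SIX preimages `(ℓ₁, ℓ₃, ℓ₅, ν)` under the formula —
  `(3,3,2,0), (3,4,1,0), (3,4,2,1), (5,1,2,0), (6,1,1,0), (6,1,2,1)` — and every one of them has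
  `ℓ₁ ≥ 3` (`soloInformed_wline_needs_long_one_strand`).  Since the W-line with `a₁ = 1` has no
  degree-`1` generator at all (`(M/XM)_1 = 0`), this certifies that the W-line lies outside the
  scope of the ramified-line theorem §16.13(j)(1): its extra units at `k = 1, …, 5` must come
  from the changed local terms of the unramified line (claim c290/c291, sketch W13).
* `soloInformed_generic_formal_reading`: the generic vector `(2, 4, 5, 7, 8, 9, 11)` of the other
  seven lines has exactly the two readings `(1, 1, 1, 0)` and `(1, 1, 2, 1)` (the known
  `ℓ₅ ↔ ν` ambiguity at `k = 5`).
-/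

namespace Summit.Langlands.Langlands.Theorems

open Finset

/-- Closed form of the three-strand (`T = {1,3,5}`) ray profile before the `ν`-correction. -/
def soloInformedProfile3 (ℓ₁ ℓ₃ ℓ₅ k : ℕ) : ℕ :=
  if k = 0 then 1 + (if 1 ≤ ℓ₁ then 1 else 0)
  else if k = 1 then 4 + (if 2 ≤ ℓ₁ then 1 else 0)
  else if k = 2 then 5 + (if 3 ≤ ℓ₁ then 1 else 0)
  else if k = 3 then 7 + (if 2 ≤ ℓ₃ then 1 else 0) + (if 4 ≤ ℓ₁ then 1 else 0)
  else if k = 4 then 8 + (if 3 ≤ ℓ₃ then 1 else 0) + (if 5 ≤ ℓ₁ then 1 else 0)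
  else if k = 5 then 9 + (if 4 ≤ ℓ₃ then 1 else 0) + (if 2 ≤ ℓ₅ then 1 else 0)
                       + (if 6 ≤ ℓ₁ then 1 else 0)
  else 11 + (if 5 ≤ ℓ₃ then 1 else 0) + (if 3 ≤ ℓ₅ then 1 else 0) + (if 7 ≤ ℓ₁ then 1 else 0)

/-- The three-strand count `1 + 3⌈k/2⌉ - [k = 5] + N_k` equals the closed form. -/
theorem soloInformed_ray_profile3 :
    ∀ ℓ₁ ∈ Icc 1 7, ∀ ℓ₃ ∈ Icc 1 7, ∀ ℓ₅ ∈ Icc 1 7, ∀ k ≤ 6,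
      1 + 3 * ((k + 1) / 2) - (if k = 5 then 1 else 0)
        + ((range (k + 1)).filter (fun i =>
            ((1 + i) % 6 = 1 ∧ k + 1 - i ≤ ℓ₁) ∨ ((1 + i) % 6 = 3 ∧ k + 1 - i ≤ ℓ₃)
              ∨ ((1 + i) % 6 = 5 ∧ k + 1 - i ≤ ℓ₅))).card
        = soloInformedProfile3 ℓ₁ ℓ₃ ℓ₅ k := by
  decide

/-- The universal W-line vector. -/
def soloInformedWVector (k : ℕ) : ℕ :=
  if k = 0 then 2 else if k = 1 then 5 else if k = 2 then 6 else if k = 3 then 8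
  else if k = 4 then 9 else if k = 5 then 10 else 11

/-- The generic `w = 1` vector. -/
def soloInformedGVector (k : ℕ) : ℕ :=
  if k = 0 then 2 else if k = 1 then 4 else if k = 2 then 5 else if k = 3 then 7
  else if k = 4 then 8 else if k = 5 then 9 else 11

/-- The W-line profile `(2,5,6,8,9,10,11)` has exactly six formal readings `(ℓ₁,ℓ₃,ℓ₅,ν)`. -/
theorem soloInformed_wline_formal_reading :
    ∀ ℓ₁ ∈ Icc 1 7, ∀ ℓ₃ ∈ Icc 1 7, ∀ ℓ₅ ∈ Icc 1 7, ∀ ν ≤ 1,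
      (∀ k ≤ 6, soloInformedProfile3 ℓ₁ ℓ₃ ℓ₅ k - (if k = 5 then ν else 0) = soloInformedWVector k)
        ↔ (ℓ₁, ℓ₃, ℓ₅, ν) ∈ ({(3,3,2,0), (3,4,1,0), (3,4,2,1), (5,1,2,0), (6,1,1,0), (6,1,2,1)} :
            Finset (ℕ × ℕ × ℕ × ℕ)) := by
  decide

/-- Every formal reading of the W-line profile needs a `1`-strand of length at least `3`. -/
theorem soloInformed_wline_needs_long_one_strand :
    ∀ ℓ₁ ∈ Icc 1 7, ∀ ℓ₃ ∈ Icc 1 7, ∀ ℓ₅ ∈ Icc 1 7, ∀ ν ≤ 1,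
      (∀ k ≤ 6, soloInformedProfile3 ℓ₁ ℓ₃ ℓ₅ k - (if k = 5 then ν else 0) = soloInformedWVector k)
        → 3 ≤ ℓ₁ := by
  decide

/-- The generic profile `(2,4,5,7,8,9,11)` has exactly the formal readings `(1,1,1,0)`, `(1,1,2,1)`. -/
theorem soloInformed_generic_formal_reading :
    ∀ ℓ₁ ∈ Icc 1 7, ∀ ℓ₃ ∈ Icc 1 7, ∀ ℓ₅ ∈ Icc 1 7, ∀ ν ≤ 1,
      (∀ k ≤ 6, soloInformedProfile3 ℓ₁ ℓ₃ ℓ₅ k - (if k = 5 then ν else 0) = soloInformedGVector k)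
        ↔ (ℓ₁, ℓ₃, ℓ₅, ν) ∈ ({(1,1,1,0), (1,1,2,1)} : Finset (ℕ × ℕ × ℕ × ℕ)) := by
  decide

end Summit.Langlands.Langlands.Theorems
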